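import Summits.Schanuel.Schanuel.Theorems.ZilberEacCancellingFibreLimits
import Mathlib.Analysis.SpecialFunctions.Pow.Asymptotics
import HarnessLib

/-!
# The double-cancelling regime: growth of the scale `Λ = ‖S‖^{e₁}` and polynomial bookkeeping

Zilber's Exponential-Algebraic Closedness, case ladder (host summit Schanuel, cell `pub-schanuel`,
seat 2, gen 15).  Along the label `n → ∞` of the double-cancelling regime (HANDOFF O59 PLAN,
`ZilberEacDoubleCancellingSystem`) the base value is `y₂ = Sω^{j₀}e^{v/e₀}` with
`S = e^{τ/e₀}`, `τ = Log(2πin/(r₀A))` (`A = a₀s ≠ 0`), so `‖S‖^{e₀} = 2πn/(|r₀|‖A‖)` and the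
cancelling depth is `Λ = ‖S‖^{e₁} = (2πn/(|r₀|‖A‖))^{e₁/e₀}`: the quantities `e^{xⱼ}` are
`O(e^{−cΛ})` while everything else is polynomial in `n`.  This file isolates the comparisons
"polynomial × `e^{−aΛ}` → 0" used by `ZilberEacDoubleCancellingExistence`.

* `norm_S_pow_eq` — `‖S‖^{k} = exp((k/e₀)(log(2π/(|r₀|‖A‖)) + log n))`, in particular
  `‖S‖^{e₀} = 2πn/(|r₀|‖A‖)`;
* `tendsto_normS_atTop`, `tendsto_Lambda_div_log_atTop` — `‖S‖ → ∞`, `Λ/log n → ∞`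
  (`0 < e₁`);
* **`tendsto_pow_mul_exp_neg_Lambda`** — `n^k e^{−aΛ} → 0` for every `k : ℕ`, `a > 0`;
* `sum_norm_coeff_pow_le` — `Σ_{i<e} ‖Bᵢ‖‖S‖^{i+1} ≤ (Σ‖Bᵢ‖)‖S‖^{e'}` for `e ≤ e'`, `1 ≤ ‖S‖`.

HONEST FRAMING: bookkeeping for explicit members of an OPEN cell (`ECCell 3 2`); NOT Schanuel's
conjecture; EAC ⇏ SC.
-/

noncomputable section

open Complex Filter Topology Asymptotics

set_option linter.dupNamespace false

namespace Summit.Schanuel.Schanuel.Theorems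

section Scale

variable {r₀ : ℝ} (hr₀ : r₀ ≠ 0) {A : ℂ} (hA : A ≠ 0)
include hr₀ hA

/-- `‖S‖^k = exp((k/e₀)·Re τ)` with `Re τ = log(2π/(|r₀|‖A‖)) + log n`, `n ≥ 1`. [folklore] -/
theorem norm_S_pow_eq (e₀ : ℕ) {n : ℕ} (hn : 1 ≤ n) (k : ℕ) :
    ‖exp (Complex.log (2 * Real.pi * I * (n : ℂ) / ((r₀ : ℂ) * A)) / (e₀ : ℂ))‖ ^ k =
      Real.exp (((k : ℝ) / e₀) * (Real.log (2 * Real.pi / (|r₀| * ‖A‖)) + Real.log n)) := by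
  have hnpos : (0 : ℝ) < n := by exact_mod_cast hn
  rw [Complex.norm_exp, ← Real.exp_nat_mul, Complex.div_natCast_re,
    show ((n : ℂ)) = (((n : ℝ)) : ℂ) by norm_cast, re_log_label_quot hnpos hr₀ hA]
  congr 1
  ring

/-- `‖S‖ → ∞`. [folklore] -/
theorem tendsto_normS_atTop (e₀ : ℕ) (he₀ : 1 ≤ e₀) :
    Tendsto (fun n : ℕ => ‖exp (Complex.log (2 * Real.pi * I * (n : ℂ) / ((r₀ : ℂ) * A)) / (e₀ : ℂ))‖)
      atTop atTop := by
  have he : (0 : ℝ) < e₀ := by exact_mod_cast he₀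
  have h1 : Tendsto (fun n : ℕ => Real.exp (((1 : ℝ) / e₀) *
      (Real.log (2 * Real.pi / (|r₀| * ‖A‖)) + Real.log n))) atTop atTop := by
    refine Real.tendsto_exp_atTop.comp ?_
    refine Tendsto.const_mul_atTop (by positivity) ?_
    exact tendsto_atTop_add_const_left _ _
      (Real.tendsto_log_atTop.comp tendsto_natCast_atTop_atTop)
  refine (h1.congr' ?_)
  filter_upwards [eventually_ge_atTop 1] with n hn
  have := norm_S_pow_eq hr₀ hA e₀ hn 1
  rw [pow_one, Nat.cast_one] at this
  exact this.symm

/-- `Λ / log n → ∞` for `Λ = ‖S‖^{e₁}`, `1 ≤ e₁`. [folklore] -/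
theorem tendsto_Lambda_div_log_atTop (e₀ : ℕ) (he₀ : 1 ≤ e₀) (e₁ : ℕ) (he₁ : 1 ≤ e₁) :
    Tendsto (fun n : ℕ =>
      ‖exp (Complex.log (2 * Real.pi * I * (n : ℂ) / ((r₀ : ℂ) * A)) / (e₀ : ℂ))‖ ^ e₁ / Real.log n)
      atTop atTop := by
  have he : (0 : ℝ) < e₀ := by exact_mod_cast he₀
  set a : ℝ := (e₁ : ℝ) / e₀ with ha
  have hapos : 0 < a := by rw [ha]; positivity
  set L₀ : ℝ := Real.log (2 * Real.pi / (|r₀| * ‖A‖)) with hL₀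
  -- `Λ = e^{aL₀} · n^a`; `n^a / log n → ∞`
  have hmain : Tendsto (fun n : ℕ => Real.exp (a * L₀) * ((n : ℝ) ^ a / Real.log n)) atTop atTop := by
    refine Tendsto.const_mul_atTop (Real.exp_pos _) ?_
    have h1 : Tendsto (fun x : ℝ => Real.log x / x ^ a) atTop (𝓝 0) :=
      (isLittleO_log_rpow_atTop hapos).tendsto_div_nhds_zero
    have h2 : Tendsto (fun n : ℕ => Real.log n / (n : ℝ) ^ a) atTop (𝓝[>] 0) := by
      refine tendsto_nhdsWithin_iff.2 ⟨h1.comp tendsto_natCast_atTop_atTop, ?_⟩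
      filter_upwards [eventually_ge_atTop 2] with n hn
      have hn' : (2 : ℝ) ≤ n := by exact_mod_cast hn
      exact div_pos (Real.log_pos (by linarith)) (Real.rpow_pos_of_pos (by linarith) _)
    have h3 := h2.inv_tendsto_nhdsGT_zero
    refine h3.congr fun n => ?_
    simp only [Pi.inv_apply, inv_div]
  refine hmain.congr' ?_
  filter_upwards [eventually_ge_atTop 1] with n hn
  have hnpos : (0 : ℝ) < n := by exact_mod_cast hn
  rw [norm_S_pow_eq hr₀ hA e₀ hn e₁, ← hL₀, show ((e₁ : ℝ) / e₀) = a from rfl, mul_add,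
    Real.exp_add, Real.rpow_def_of_pos hnpos]
  ring_nf

/-- **Polynomial × `e^{−aΛ}` → 0.** [folklore] -/
theorem tendsto_pow_mul_exp_neg_Lambda (e₀ : ℕ) (he₀ : 1 ≤ e₀) (e₁ : ℕ) (he₁ : 1 ≤ e₁) (k : ℕ)
    {a : ℝ} (ha : 0 < a) :
    Tendsto (fun n : ℕ => (n : ℝ) ^ k * Real.exp (-(a *
      ‖exp (Complex.log (2 * Real.pi * I * (n : ℂ) / ((r₀ : ℂ) * A)) / (e₀ : ℂ))‖ ^ e₁))) atTop (𝓝 0) := by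
  have hΛ := tendsto_Lambda_div_log_atTop hr₀ hA e₀ he₀ e₁ he₁
  -- eventually `aΛ ≥ (k+1) log n`, so the sequence is `≤ 1/n`
  have hev : ∀ᶠ n : ℕ in atTop, ((k : ℝ) + 1) / a ≤
      ‖exp (Complex.log (2 * Real.pi * I * (n : ℂ) / ((r₀ : ℂ) * A)) / (e₀ : ℂ))‖ ^ e₁ / Real.log n :=
    hΛ.eventually_ge_atTop _
  have hinv : Tendsto (fun n : ℕ => 1 / (n : ℝ)) atTop (𝓝 0) := tendsto_one_div_atTop_nhds_zero_nat
  refine squeeze_zero' (Eventually.of_forall fun n => by positivity) ?_ hinv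
  filter_upwards [hev, eventually_ge_atTop 2] with n hn hn2
  have hn2' : (2 : ℝ) ≤ n := by exact_mod_cast hn2
  have hnpos : (0 : ℝ) < n := by linarith
  have hlog : 0 < Real.log n := Real.log_pos (by linarith)
  set Λ := ‖exp (Complex.log (2 * Real.pi * I * (n : ℂ) / ((r₀ : ℂ) * A)) / (e₀ : ℂ))‖ ^ e₁ with hΛdef
  have h1 : ((k : ℝ) + 1) * Real.log n ≤ a * Λ := by
    have := (div_le_div_iff₀ ha hlog).1 hn
    linarith
  calc (n : ℝ) ^ k * Real.exp (-(a * Λ)) ≤ (n : ℝ) ^ k * Real.exp (-(((k : ℝ) + 1) * Real.log n)) :=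
        mul_le_mul_of_nonneg_left (Real.exp_le_exp.2 (by linarith)) (by positivity)
    _ = 1 / n := by
        rw [show -(((k : ℝ) + 1) * Real.log n) = -((((k + 1 : ℕ)) : ℝ) * Real.log n) by push_cast; ring,
          ← Real.log_pow, Real.exp_neg, Real.exp_log (by positivity), pow_succ]
        field_simp

end Scale

section Sums

/-- `Σ_{i<e} ‖Bᵢ‖ s^{i+1} ≤ (Σ_{i<e} ‖Bᵢ‖) s^{e'}` for `1 ≤ s` and `e ≤ e'`. [folklore] -/
theorem sum_norm_coeff_pow_le (B : ℕ → ℂ) {e e' : ℕ} (he : e ≤ e') {s : ℝ} (hs : 1 ≤ s) :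
    ∑ i ∈ Finset.range e, ‖B i‖ * s ^ (i + 1) ≤ (∑ i ∈ Finset.range e, ‖B i‖) * s ^ e' := by
  rw [Finset.sum_mul]
  refine Finset.sum_le_sum fun i hi => ?_
  have hi' : i < e := Finset.mem_range.1 hi
  exact mul_le_mul_of_nonneg_left (pow_le_pow_right₀ hs (by omega)) (norm_nonneg _)

end Sums

end Summit.Schanuel.Schanuel.Theorems

end
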